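import Summits.HodgeConjecture.HodgeConjecture.Theorems.Ring2AbelianAllAndreFibreGysinRange
import HarnessLib

/-!
# Ring 2 · sub-cell AbelianAll (ALL ABELIAN VARIETIES), André axis, part XXVI-c — `ker j_{t*} = (Im j_t^*)^⊥`, `Im j_t^* = (ker j_{t*})^⊥`,
# and the Poincaré pairing of a smooth fibre is NON-DEGENERATE ON THE INVARIANT PART, for every smooth projective family over a
# smooth projective base

HONEST FRAMING (page 1, verbatim): **research route, not a corollary; conditional on HC_CM plus one named
minimal statement.** Cell line: research route conditional on HC_CM; not a corollary; Q11.4-sentence-2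
already refuted in dim ≥ 3. Nothing in this file proves a case of the Hodge conjecture for an abelian variety; `HC_CM` does not occur
in it; item `Theses.RankFourFaces.CMToAbelian` (stmt-16267) OPEN and not closed here. Seat `pub-hodge-ring2-ab-andre-2`, gen 18;
brief (iii) "attack `B_min`: what is known".

## What this file proves (theorems only; no definition, no named fact, no sorry)

Complements to part XXVI-a (`range j_{t*} = j_{t*}(Im j_t^*)`, `Hᵃ(X_t) = Im j_t^* ⊕ ker j_{t*}`), for a smooth projective family `f : 𝒳 ⟶ S`
of relative dimension `n` over a smooth projective base of any dimension, a point `t`, `j_t = fiberι f t`, degrees `a + a' = 2n`, and the cup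
pairing `⟨x ∪ y, [X_t(ℂ)]⟩` of the closed oriented manifold `X_t(ℂ)` (`cupPairing (complexOrientationFamily _)`):

* **`complexGysin_fiberι_eq_zero_iff`: `ker j_{t*} = (Im j_t^*)^⊥`** — `j_{t*} x = 0 ⟺ ⟨x ∪ j_t^* z, [X_t]⟩ = 0` for all global `z` (transposition
  `⟨j_{t*} x ∪ z, [𝒳]⟩ = ⟨x ∪ j_t^* z, [X_t]⟩` and Poincaré duality on `𝒳(ℂ)`): the print DEFINITION of the co-vanishing part;
* **`exists_cupPairing_map_fiberι_ne_zero`: the Poincaré pairing of `X_t` restricted to `Im j_t^*|ₐ × Im j_t^*|_{a'}` is non-degenerate** (a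
  non-zero `j_t^* W` pairs non-trivially with some `j_t^* z`) — in print the polarisation / semisimplicity argument of Deligne (Hodge II 4.2.6ff),
  the statement parts XIV-e/XIV-g/XXI quote as "Poincaré duality on the fibre restricted to the invariants"; here a corollary of the tree theorem
  `ker j_{t*} ∩ Im j_t^* = 0` (part XII-e);
* **`mem_range_map_fiberι_of_forall_cupPairing_eq_zero`: `Im j_t^* = (ker j_{t*})^⊥`** — a class of the fibre orthogonal to the co-vanishing part
  `ker j_{t*}|_{a'}` is the restriction of a global class (`⊆` by transposition; `=` by the dimension count of part XXVI-a and perfectness of the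
  pairing of `X_t(ℂ)`: the annihilator of `ker j_{t*}|_{a'}` has dimension `rank j_{t*}|_{a'} = dim Im j_t^*|_{a'} = dim Im j_t^*|ₐ`).

Together with part XXVI-a: `Hᵃ(X_t) = Im j_t^* ⊕ ker j_{t*}` is an ORTHOGONAL-TYPE decomposition — each summand is the annihilator of the other in
the complementary degree — which is the tree's fact-free form of "`Hᵃ(X_t) = Hᵃ(X_t)^π ⊕ (variant part)`, both summands non-degenerate".

## Honest status

No node is born; nothing is minimal; nothing here is progress on `HC_AV` by itself: unconditional structure theorems on the cohomology of smooth
projective families (tools for the André axis and for the other axes' lift / transport arguments).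

References: DeligneHodgeII1971 (Thm. 4.1.1, Thm. 4.2.6, Cor. 4.2.8); VoisinHodgeII2003 (§4.3.1 Thm. 4.18, §4.3.3 Thm. 4.24);
FultonYoungTableaux1997 (App. B (5)–(6)); HatcherAT2002 (§3.3 Prop. 3.38).
-/

noncomputable section

set_option linter.dupNamespace false

namespace Summit.HodgeConjecture.HodgeConjecture.Ring2.AbelianAll

open CategoryTheory AlgebraicGeometry
open Literature.AlgebraicGeometry Literature.AlgebraicGeometry.Motives
open Literature.AlgebraicGeometry.HodgeTheory

/-! ## §1 `ker j_{t*} = (Im j_t^*)^⊥`, non-degeneracy on the invariants, `Im j_t^* = (ker j_{t*})^⊥` -/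

section Complements

open Literature.AlgebraicTopology.SingularHomology (cupPairing cupPairing_apply cupProduct_gradedComm_holds
  isPerfPair_cupPairing_of_field_holds)
open Summit.HodgeConjecture.HodgeConjecture.Theorems (cupPairing_complexGysin_complexOrientationFamily)

variable {𝒳 S : SchemeOver ℂ} {n m N : ℕ} {f : 𝒳 ⟶ S}

/-- **`ker j_{t*} = (Im j_t^*)^⊥`**: a class `x ∈ Hᵃ(X_t(ℂ); ℂ)` is killed by the Gysin morphism of the fibre iff `⟨x ∪ j_t^* z, [X_t(ℂ)]⟩ = 0` for
every global `z ∈ H^{a'}(𝒳(ℂ); ℂ)`, `a + a' = 2n` (transposition `⟨j_{t*} x ∪ z, [𝒳]⟩ = ⟨x ∪ j_t^* z, [X_t]⟩` and Poincaré duality on `𝒳(ℂ)`) — the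
print definition of the co-vanishing part. [cite: FultonYoungTableaux1997, Appendix B §B.1 (5)–(6)] [cite: HatcherAT2002, §3.3 Prop. 3.38]
[cite: VoisinHodgeII2003, §4.3.3 Thm. 4.24] -/
theorem complexGysin_fiberι_eq_zero_iff (hS : IsSmoothProjective m S) (hf : IsSmoothProjectiveFamily f n)
    (h𝒳 : IsSmoothProjective N 𝒳) {a b a' : ℕ} (hab : a + 2 * N = b + 2 * n) (haa : a + a' = 2 * n) (t : ComplexPoints S)
    (x : complexBetti (fiberOver f t) a) :
    complexGysin complexOrientationFamily (hf.isSmoothProjective t) h𝒳 (fiberι f t) hab x = 0 ↔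
      ∀ z : complexBetti 𝒳 a',
        cupPairing (complexOrientationFamily (hf.isSmoothProjective t)) haa x (complexBetti.map (fiberι f t) a' z) = 0 := by
  obtain rfl : N = n + m := dim_total_eq_add hS hf h𝒳
  letI := h𝒳.chartedSpace
  haveI := ComplexPoints.compactSpace_of_isSmoothProjective h𝒳
  haveI := ComplexPoints.t2Space_of_isSmoothProjective h𝒳
  have hba' : b + a' = 2 * (n + m) := by omega
  constructor
  · intro hx z
    rw [← cupPairing_complexGysin_complexOrientationFamily (fiberι f t) h𝒳 (hf.isSmoothProjective t) hab haa hba' x z, hx, map_zero,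
      LinearMap.zero_apply]
  · intro hx
    have hPerf : (cupPairing (complexOrientationFamily h𝒳) hba').IsPerfPair := isPerfPair_cupPairing_of_field_holds
    refine (LinearMap.IsPerfPair.bijective_left (cupPairing (complexOrientationFamily h𝒳) hba')).1 ?_
    rw [map_zero]
    ext z
    rw [LinearMap.zero_apply, cupPairing_complexGysin_complexOrientationFamily (fiberι f t) h𝒳 (hf.isSmoothProjective t) hab haa hba' x z]
    exact hx z

/-- **The Poincaré pairing of a smooth fibre is non-degenerate on the invariant part**: a non-zero invariant class `j_t^* W ∈ Hᵃ(X_t)` pairs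
non-trivially with some invariant class `j_t^* z ∈ H^{a'}(X_t)`, `a + a' = 2n` (`j_t^* W ≠ 0 ⟹ j_{t*} j_t^* W ≠ 0` by Deligne's `ker j_{t*} ∩ Im j_t^* = 0`,
part XII-e; then `ker j_{t*} = (Im j_t^*)^⊥`). In print this is the polarisation / semisimplicity argument (Deligne); here a corollary of the tree
theorem. [cite: DeligneHodgeII1971, Thm. 4.1.1 and Thm. 4.2.6] [cite: VoisinHodgeII2003, §4.3.1 Thm. 4.18 and §4.3.3 Thm. 4.24] -/
theorem exists_cupPairing_map_fiberι_ne_zero (hS : IsSmoothProjective m S) (hf : IsSmoothProjectiveFamily f n)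
    (h𝒳 : IsSmoothProjective N 𝒳) {a a' : ℕ} (haa : a + a' = 2 * n) (t : ComplexPoints S) (W : complexBetti 𝒳 a)
    (hW : complexBetti.map (fiberι f t) a W ≠ 0) :
    ∃ z : complexBetti 𝒳 a', cupPairing (complexOrientationFamily (hf.isSmoothProjective t)) haa
      (complexBetti.map (fiberι f t) a W) (complexBetti.map (fiberι f t) a' z) ≠ 0 := by
  obtain rfl : N = n + m := dim_total_eq_add hS hf h𝒳
  have hab : a + 2 * (n + m) = (a + 2 * m) + 2 * n := by ring
  by_contra h
  push Not at h
  exact hW (deligne1971_fibreGysin_injOn_restricted_holds f hS hf h𝒳 hab t W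
    ((complexGysin_fiberι_eq_zero_iff hS hf h𝒳 hab haa t _).2 h))

/-- **`Im j_t^* = (ker j_{t*})^⊥`**: a class `x ∈ Hᵃ(X_t(ℂ); ℂ)` pairing to zero with `ker j_{t*} ⊆ H^{a'}(X_t)` (`a + a' = 2n`) is the restriction
of a global class. (`⊆`: transposition; `=` by dimensions: the annihilator of `ker j_{t*}|_{a'}` has dimension `rank j_{t*}|_{a'} =
dim Im j_t^*|_{a'} = dim Im j_t^*|ₐ` — part XXVI-a — and the Poincaré pairing of `X_t(ℂ)` is perfect.)
[cite: DeligneHodgeII1971, Thm. 4.1.1 and Cor. 4.2.8] [cite: VoisinHodgeII2003, §4.3.3 Thm. 4.24] [cite: HatcherAT2002, §3.3 Prop. 3.38] -/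
theorem mem_range_map_fiberι_of_forall_cupPairing_eq_zero (hS : IsSmoothProjective m S) (hf : IsSmoothProjectiveFamily f n)
    (h𝒳 : IsSmoothProjective N 𝒳) {a a' b' : ℕ} (haa : a + a' = 2 * n) (hab' : a' + 2 * N = b' + 2 * n) (t : ComplexPoints S)
    (x : complexBetti (fiberOver f t) a)
    (hx : ∀ y : complexBetti (fiberOver f t) a',
      complexGysin complexOrientationFamily (hf.isSmoothProjective t) h𝒳 (fiberι f t) hab' y = 0 →
        cupPairing (complexOrientationFamily (hf.isSmoothProjective t)) haa x y = 0) :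
    x ∈ LinearMap.range (complexBetti.map (fiberι f t) a).hom := by
  obtain rfl : N = n + m := dim_total_eq_add hS hf h𝒳
  haveI : Module.Finite ℂ (complexBetti (fiberOver f t) a) := finite_complexBetti (hf.isSmoothProjective t) _
  haveI : Module.Finite ℂ (complexBetti (fiberOver f t) a') := finite_complexBetti (hf.isSmoothProjective t) _
  haveI : Module.Finite ℂ (complexBetti 𝒳 a) := finite_complexBetti h𝒳 _
  letI := (hf.isSmoothProjective t).chartedSpace
  haveI := ComplexPoints.compactSpace_of_isSmoothProjective (hf.isSmoothProjective t)
  haveI := ComplexPoints.t2Space_of_isSmoothProjective (hf.isSmoothProjective t)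
  have ha'a : a' + a = 2 * n := by omega
  have hba : b' + a = 2 * (n + m) := by omega
  -- dimension facts (stated before naming the subspaces, so that `set` rewrites them)
  have h1 := LinearMap.finrank_range_add_finrank_ker
    (complexGysin complexOrientationFamily (hf.isSmoothProjective t) h𝒳 (fiberι f t) hab')
  have h2 := finrank_range_complexGysin_fiberι_eq hS hf h𝒳 hab' t
  have h3 := finrank_range_map_fiberι_eq_of_add hS hf h𝒳 haa t
  set K' := LinearMap.ker (complexGysin complexOrientationFamily (hf.isSmoothProjective t) h𝒳 (fiberι f t) hab') with hK'
  set V := LinearMap.range (complexBetti.map (fiberι f t) a).hom with hV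
  set P := cupPairing (complexOrientationFamily (hf.isSmoothProjective t)) haa with hP
  -- the annihilator of `K'` in `Hᵃ(X_t)` under the cup pairing
  set Ann : Submodule ℂ (complexBetti (fiberOver f t) a) := K'.dualAnnihilator.comap P with hAnn
  have hxAnn : x ∈ Ann := by
    rw [hAnn, Submodule.mem_comap, Submodule.mem_dualAnnihilator]
    intro y hy
    exact hx y (LinearMap.mem_ker.1 hy)
  -- `V ≤ Ann`: `⟨j^* W ∪ y, [X_t]⟩ = ± ⟨y ∪ j^* W, [X_t]⟩ = ± ⟨j_{t*} y ∪ W, [𝒳]⟩ = 0` for `y ∈ K'`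
  have hVle : V ≤ Ann := by
    rintro _ ⟨W, rfl⟩
    rw [hAnn, Submodule.mem_comap, Submodule.mem_dualAnnihilator]
    intro y hy
    have h1 : cupPairing (complexOrientationFamily (hf.isSmoothProjective t)) ha'a y (complexBetti.map (fiberι f t) a W) = 0 := by
      rw [← cupPairing_complexGysin_complexOrientationFamily (fiberι f t) h𝒳 (hf.isSmoothProjective t) hab' ha'a hba y W,
        LinearMap.mem_ker.1 hy, map_zero, LinearMap.zero_apply]
    change cupPairing (complexOrientationFamily (hf.isSmoothProjective t)) haa ((complexBetti.map (fiberι f t) a).hom W) y = 0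
    rw [cupPairing_apply, cupProduct_gradedComm_holds ℂ _ haa ha'a, map_smul, LinearMap.smul_apply, ← cupPairing_apply]
    change ((-1 : ℂ) ^ (a * a')) • cupPairing (complexOrientationFamily (hf.isSmoothProjective t)) ha'a y
      (complexBetti.map (fiberι f t) a W) = 0
    rw [h1, smul_zero]
  -- dimensions: `dim Ann ≤ dim K'^⊥ = dim H^{a'} − dim K' = rank j_{t*}|_{a'} = dim Im j_t^*|_{a'} = dim V`
  have hPerf : P.IsPerfPair := isPerfPair_cupPairing_of_field_holds
  have hPinj : Function.Injective P := (LinearMap.IsPerfPair.bijective_left P).1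
  have h4 := Subspace.finrank_add_finrank_dualAnnihilator_eq K'
  have h5 : Module.finrank ℂ Ann ≤ Module.finrank ℂ K'.dualAnnihilator :=
    calc Module.finrank ℂ Ann = Module.finrank ℂ (Ann.map P) := (Submodule.equivMapOfInjective P hPinj Ann).finrank_eq
      _ ≤ Module.finrank ℂ K'.dualAnnihilator := Submodule.finrank_mono (Submodule.map_comap_le P _)
  have h6 : Module.finrank ℂ V ≤ Module.finrank ℂ Ann := Submodule.finrank_mono hVle
  have hVeq : V = Ann := Submodule.eq_of_le_of_finrank_eq hVle (by omega)
  rw [hVeq]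
  exact hxAnn

end Complements

end Summit.HodgeConjecture.HodgeConjecture.Ring2.AbelianAll

end
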